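import Summits.AnomalousDissipation.AnomalousDissipation.Theses.ImpulseGrid

/-!
# Sketch — crux idea `haberman-throttled-grid-wind` for `ImpulseGrid.BoundedEnergyNoLeakGrid`
(crux-ideate stmt-AnomalousDissipation-14350, round 1, ideator 1). Statements only (no proofs, no sorries):

* `RegularDriftStatesSuffice` — the TRANSFER (first lemma, provable now): global CLASSICAL drift families with
  ν-uniformly bounded mean energy witness the crux; the no-leak clause is discharged by the exact energy equality
  `Torus.IsClassicalNSSolutionOn.energy_eq` + `….isGlobalLerayHopf` (both proved in tree).
* `gridWind`, `gridMeanForce` — the Kolmogorov wind `U·Im e^{2πi n x₂} • e₁` and the resonant grid mean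
  `Im e^{2πi m x₁} • e₂` (shear sub-design, unit-mass slab Φ averaged out).
* `SameShellNoSweep` — structural identity (provable now): for n = m = 1 the linearised Euler coupling of wind and
  laminar mode is an exact gradient, so a same-shell wind cannot detune the resonant mean (Marchioro at linear order).
* `SweptLayerUniformEnergy` — first ANALYTIC stub of the line (2-D sector k₀ = 0, linear, wind coarser than the
  force n < m): the steady linearised swept-ripple problem has solutions with ν-UNIFORMLY bounded energy
  (log-singular inflectional critical layers; toy numerics toy/swept_linear.out: ∫|w|² → 0.0268 for (m,n)=(2,1)).
Second idea `drift-plane-roll-absorber`: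
* `rollAbsorberC0`, `RollAbsorberC0IsEuler` — an EXPLICIT steady Euler absorber of a gravest-pattern unit-mass grid
  force at zero drift (provable now; checked numerically, toy/roll_absorber_check.py);
* `rollField`, `DriftPlaneRollAbsorber` — the drift-frame cat's-eye rolls and the first analytic stub (steady transport
  of axial momentum solvable by reflection symmetry for every shear pattern sin(2πm x₁), m ≥ 1).
-/

namespace Summit.AnomalousDissipation.AnomalousDissipation.Cruxes.BoundedEnergyNoLeakGrid.Ideas

open scoped BigOperators Topology InnerProductSpace
open Filter Set MeasureTheory
open Literature.Analysis.FunctionSpaces.Torus Literature.Analysis.FluidPDE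

local notation "𝕋³" => UnitAddTorus (Fin 3)
local notation "E³" => EuclideanSpace ℝ (Fin 3)

/-- unit vectors -/
noncomputable def e (i : Fin 3) : E³ := EuclideanSpace.single i (1 : ℝ)

/-- The Kolmogorov WIND of amplitude `U` at transverse wavenumber `n`: `U sin(2π n x₂) e₁` (steady Euler with any
drift `c e₀`, zero mean; it sweeps the fluid ACROSS the grid pattern direction x₁). -/
noncomputable def gridWind (U : ℝ) (n : ℕ) : 𝕋³ → E³ :=
  fun x => (U * (UnitAddTorus.mFourier (Pi.single (2 : Fin 3) (n : ℤ)) x).im) • e 1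

/-- The RESONANT GRID MEAN of the shear sub-design: `sin(2π m x₁) e₂` (the x₀-average `(∫Φ)·G = G` of the grid force
`Φ(x₀) G(x⊥)`, unit-mass slab). -/
noncomputable def gridMeanForce (m : ℕ) : 𝕋³ → E³ :=
  fun x => ((UnitAddTorus.mFourier (Pi.single (1 : Fin 3) (m : ℤ)) x).im) • e 2

/-- TRANSFER (first lemma; provable now, size M). Regular drift families suffice: if for every grid design there are
ν_j → 0⁺ and GLOBAL CLASSICAL solutions `(u_j, p_j)` of NS_{ν_j} forced by `Φ•G` with drift momentum `∫u_j(0) = c e₀`,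
per-j sup-in-time energy bounds and ν-uniformly bounded limsup-mean energy, then `BoundedEnergyNoLeakGrid` holds:
classical ⇒ global Leray–Hopf from `u_j 0` (`Torus.IsClassicalNSSolutionOn.isGlobalLerayHopf`), and the exact energy
equality (`….energy_eq`) with bounded energy gives `limsup-mean ⟨f,u_j⟩ = meanDissipation` (the o(1/T) boundary term
drops out of the limsup; spectral = pointwise gradient norm on smooth slices, `gradNormSq_eq_toReal_eGradNormSq`). -/
def RegularDriftStatesSuffice : Prop :=
  (∀ (Φ : 𝕋³ → ℝ) (G : 𝕋³ → E³) (c : ℝ), IsSmooth Φ → IsSmooth G →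
    (∀ (s : UnitAddCircle) x, Φ (x + Pi.single (1 : Fin 3) s) = Φ x ∧ Φ (x + Pi.single (2 : Fin 3) s) = Φ x) →
    (∫ x, Φ x = 1) → (∀ (s : UnitAddCircle) x, G (x + Pi.single (0 : Fin 3) s) = G x) → (∀ x, G x 0 = 0) →
    IsSmooth (fun x => Φ x • G x) → IsDivFree (fun x => Φ x • G x) → HasZeroMean (fun x => Φ x • G x) → 0 < c →
    ∃ (ν : ℕ → ℝ) (u : ℕ → ℝ → 𝕋³ → E³) (p : ℕ → ℝ → 𝕋³ → ℝ),
      (∀ j, 0 < ν j) ∧ Tendsto ν atTop (𝓝 0) ∧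
      (∀ j, IsClassicalNSSolutionOn univ (ν j) (fun _ => fun x => Φ x • G x) (u j) (p j)) ∧
      (∀ j, ∫ x, u j 0 x = c • e 0) ∧
      (∀ j, ∃ C : ℝ, ∀ t : ℝ, 0 ≤ t → kineticEnergy (u j t) ≤ C) ∧
      ∃ E : ℝ, ∀ j, meanEnergy (u j) ≤ E) →
  Summit.AnomalousDissipation.AnomalousDissipation.Theses.ImpulseGrid.BoundedEnergyNoLeakGrid

/-- STRUCTURAL IDENTITY (provable now, size S): a wind in the force's own Stokes shell does not sweep it. For the
first-shell wind `U sin(2πx₂)e₁` and the first-shell laminar mode `sin(2πx₁)e₂` the symmetrised convection is the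
exact gradient `∇(−U cos 2πx₁ cos 2πx₂)`; hence the linearised steady problem leaves the laminar response `∝ 1/ν`
(toy/swept_linear.out, case m = n = 1: ∫|w|² = 0.0321/ν² exactly) — the linear shadow of Marchioro's rigidity. -/
def SameShellNoSweep : Prop :=
  ∀ (U : ℝ) (x : 𝕋³),
    convect (gridWind U 1) (gridMeanForce 1) x + convect (gridMeanForce 1) (gridWind U 1) x =
      gradient (fun y : 𝕋³ => -U * ((UnitAddTorus.mFourier (Pi.single (1 : Fin 3) (1 : ℤ)) y).re *
        (UnitAddTorus.mFourier (Pi.single (2 : Fin 3) (1 : ℤ)) y).re)) x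

/-- FIRST ANALYTIC STUB (2-D sector, linear): uniform-in-ν energy of the swept ripple. For a Kolmogorov wind coarser
than the grid (`0 < n < m`) the steady linearised Navier–Stokes problem about `gridWind U n` forced by the resonant
mean `gridMeanForce m` has, for every ν ∈ (0,1], a smooth x₀-invariant zero-mean solution whose ENERGY is bounded
independently of ν (inviscid limit: streamwise velocity `~ log|x₂ − x₂*|` at the inflectional critical levels,
vorticity `~ 1/(x₂ − x₂*)` regularised in Tollmien layers of width (ν/(2πm·2πnU))^{1/3}; enstrophy ~ ν^{-1/3},
dissipation ~ ν^{2/3} → 0, work → the ν-independent Plemelj rate, all of it handed to the wind at LINEAR order —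
which is why the witness needs Haberman's nonlinear layer, see the card). -/
def SweptLayerUniformEnergy : Prop :=
  ∀ (U : ℝ) (m n : ℕ), 0 < U → 0 < n → n < m → ∃ C : ℝ, ∀ ν : ℝ, 0 < ν → ν ≤ 1 →
    ∃ (w : 𝕋³ → E³) (q : 𝕋³ → ℝ), IsSmooth w ∧ IsSmooth q ∧ IsDivFree w ∧ HasZeroMean w ∧
      (∀ (s : UnitAddCircle) x, w (x + Pi.single (0 : Fin 3) s) = w x) ∧
      (∀ x, convect (gridWind U n) w x + convect w (gridWind U n) x + gradient q x - ν • laplacian w x =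
        gridMeanForce m x) ∧
      ∫ x, ‖w x‖ ^ 2 ≤ C

/-! ### Second idea `drift-plane-roll-absorber` (body-forced vortex–wave interaction) -/

/-- The explicit c = 0 ROLL ABSORBER (toy/roll_absorber_check.py: curl residual 3e-6 = FD noise): cellular rolls in the
(x₀,x₁) plane plus an axial flow, `u_E = (√2·B sin2πx₀ sin2πx₁, √2·B cos2πx₀ cos2πx₁, A cos2πx₀)`. -/
noncomputable def rollAbsorberC0 (A B : ℝ) : 𝕋³ → E³ :=
  fun x => (Real.sqrt 2 * B * (UnitAddTorus.mFourier (Pi.single (0 : Fin 3) (1 : ℤ)) x).im *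
      (UnitAddTorus.mFourier (Pi.single (1 : Fin 3) (1 : ℤ)) x).im) • e 0 +
    (Real.sqrt 2 * B * (UnitAddTorus.mFourier (Pi.single (0 : Fin 3) (1 : ℤ)) x).re *
      (UnitAddTorus.mFourier (Pi.single (1 : Fin 3) (1 : ℤ)) x).re) • e 1 +
    (A * (UnitAddTorus.mFourier (Pi.single (0 : Fin 3) (1 : ℤ)) x).re) • e 2

/-- EXACT EULER ABSORBER OF A GRAVEST GRID FORCE (provable now, size S–M, torus character calculus): `u_E` above is
smooth, divergence free, mean zero, and `(u_E·∇)u_E = ∇π − 2√2·π·A·B·sin²(2πx₀)·sin(2πx₁)·e₂`, i.e. it is a steady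
Euler state under the grid force `Φ(x₀)g(x₁)e₂` with the UNIT-MASS slab `Φ = 2 sin²(2πx₀) = 1 − cos 4πx₀` and the
GRAVEST shear pattern `g = −√2·π·A·B·sin(2πx₁)`; energy `∫|u_E|² = B² + A²/2`, minimised over `AB = const` at a
ν-free value ∝ |g| (the pressure is a sum of cos 4πx₀, cos 4πx₁ terms; stated existentially). This is the drift-free
(c = 0) shadow of the card's skeleton. -/
def RollAbsorberC0IsEuler : Prop :=
  ∀ (A B : ℝ), IsSmooth (rollAbsorberC0 A B) ∧ IsDivFree (rollAbsorberC0 A B) ∧ HasZeroMean (rollAbsorberC0 A B) ∧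
    ∃ π : 𝕋³ → ℝ, IsSmooth π ∧ ∀ x,
      convect (rollAbsorberC0 A B) (rollAbsorberC0 A B) x =
        gradient π x - (2 * Real.sqrt 2 * Real.pi * A * B *
          ((UnitAddTorus.mFourier (Pi.single (0 : Fin 3) (1 : ℤ)) x).im) ^ 2 *
          (UnitAddTorus.mFourier (Pi.single (1 : Fin 3) (1 : ℤ)) x).im) • e 2

/-- The drift-plane CAT'S-EYE ROLL FIELD `v = ∇⊥ψ`, `ψ = A(sin 2πy₀ + ε cos 2πx₁)` (first shell of the (y₀,x₁) plane:
a steady 2-D Euler flow for every A, ε; with the drift it is a travelling wave `v(x₀ − ct, x₁)`): components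
`(−2πAε sin 2πx₁, −2πA cos 2πy₀, 0)`. Its four stagnation points sit at x₁ ∈ {0, ½}, on the zeros of every shear
pattern `sin(2πm x₁)`, and every streamline is invariant under x₁ ↦ −x₁. -/
noncomputable def rollField (A ε : ℝ) : 𝕋³ → E³ :=
  fun x => (-(2 * Real.pi * A * ε) * (UnitAddTorus.mFourier (Pi.single (1 : Fin 3) (1 : ℤ)) x).im) • e 0 +
    (-(2 * Real.pi * A) * (UnitAddTorus.mFourier (Pi.single (0 : Fin 3) (1 : ℤ)) x).re) • e 1

/-- FIRST ANALYTIC STUB of the second idea (Euler level, drift frame): the resonant grid mean of ANY shear design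
`sin(2πm x₁) e₂` (m ≥ 1, gravest included) is absorbed as AXIAL momentum advected by finite-amplitude cat's-eye rolls:
for 0 < ε < 1 there is a bounded (weak, x₂-invariant) solution `w` of the steady transport equation `v·∇w = sin(2πm x₁)`
— solvability = zero average of the odd source on every (x₁-reflection-invariant) streamline + source vanishing at the
stagnation points; `u = c e₀ + v(x₀−ct,x₁) + w(x₀−ct,x₁) e₂` is then a bounded travelling-wave Euler skeleton. -/
def DriftPlaneRollAbsorber : Prop :=
  ∀ (m : ℕ) (A ε : ℝ), 0 < m → 0 < A → 0 < ε → ε < 1 →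
    ∃ (w : 𝕋³ → ℝ) (C : ℝ), (∀ x, |w x| ≤ C) ∧ AEStronglyMeasurable w volume ∧
      (∀ (s : UnitAddCircle) x, w (x + Pi.single (2 : Fin 3) s) = w x) ∧
      ∀ φ : 𝕋³ → ℝ, IsSmooth φ →
        ∫ x, w x * inner ℝ (rollField A ε x) (gradient φ x) =
          -∫ x, (UnitAddTorus.mFourier (Pi.single (1 : Fin 3) (m : ℤ)) x).im * φ x

end Summit.AnomalousDissipation.AnomalousDissipation.Cruxes.BoundedEnergyNoLeakGrid.Ideas
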